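import Summits.BirchSwinnertonDyer.BirchSwinnertonDyer.Theorems.SchneiderFreeAdditiveX3ControlLeMinimal
import Summits.BirchSwinnertonDyer.BirchSwinnertonDyer.Theorems.SchneiderFreeAdditiveX3BranchIMCKrizLiLocus
import HarnessLib

/-!
# Route `SchneiderFreeAdditiveX3` — the rung LEAF `AdditiveX3RankOneLower` AT EVERY PAIR OF THE DOOR THAT
# ADMITS A KRIZ–LI HEEGNER DATUM, from `PrintedFacts`, Poitou–Tate duality and Kriz–Li 2019 Thm. 1.20 —
# with NO branch main conjecture (cruxes r2 `PotMultBranchIMC` / r3 `GordTwoBranchIMC` not used)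

Cell `bsd-schneider-ideate`, seat `bsd-schneider-door-c2` (prover, gen 7), `--supports
stmt-BirchSwinnertonDyer-19176 --as helper` (leaf load-bearing, hence in the route file's import cone by
`…ControlLeMinimal`; director-bsd 2026-08-26T19:10Z rule). HONEST FRAMING: BSD is not advanced beyond this
reduction; NO item closes by name (the leaf quantifies over ALL pairs of the cells; here the pair must carry
a Heegner datum of the door at which the hypotheses (1)–(4) of Kriz–Li's theorem hold — a per-pair condition
whose class-wide availability is a Goldfeld-type statement NOT in the tree); the named facts enter BY NAME:
`PrintedFacts` (route item 19184: thirteen published facts), `poitouTate_selmerStructure_duality` (conjunct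
(i) of `ControlFacts`, item 19538) and `KrizLi2019.thm120_padicLogHeegner_unit_of_bernoulli` (Kriz–Li, Forum
Math. Sigma 7 (2019) e15, Thm. 1.20, PUBLISHED; no `p ∤ N` hypothesis).

## What is proved

* `missingLowerBoundAt_of_printedFacts_of_pt_of_krizLiDatum` — for `(W, p)` on the door's cells
  (`r_an = 1`, `p ≠ 2`, `ClassX3`, semistable twist) and a Heegner datum `(N = N_W, K, Dt, H, ι, P)` OF THE
  DOOR (`K` imaginary quadratic, `d_K` odd, `p ∤ #𝓞_K^×`, Heegner hypothesis for `N`, `L(E^{d_K},1) ≠ 0`,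
  `ι(P)` the Heegner point of `Dt`, `P` non-torsion) carrying Kriz–Li's binders (`ψ`, `ω`, `f`, trace form of
  `E[p]^{ss} ≅ 𝔽_p(ψ) ⊕ 𝔽_p(ψ⁻¹ω)`, (1)–(3); `ε_K`, (4)): **`Typed.MissingLowerBoundAt W p`** — the body of
  the rung leaf `SchneiderFree.AdditiveX3RankOneLower` at `(W, p)` (the lower half of BSD_p). Assembly =
  the route's `closes` run at THIS datum: STEP L at the datum from the Kriz–Li socket at every frame
  (`additiveIMCLowerBDPOnTreeLeAt_of_thm120`, p468007) + CTL₀ and the control inequality from Poitou–Tate +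
  Kolyvagin (door-c4 g4 `exists_hasCharValuationAt_of_pt_of_kolyvagin`,
  `additiveControlLeOnTreeAt_of_pt_of_kolyvagin`, link `indexLowerBoundLeAt_of_frames_of_shaFinite_le`), the
  twist model `Wd` on the same cells (door-c5's `classX3_twist_of_heegner` / `subSemistableTwist_twist_of_heegner`),
  `JointLowerManin` (item 19180, closed) and `PartnerUpperRankZero` (item 19181, closed) by their tree proofs.
* `additiveX3RankOneLower_onKrizLiLocus_of_printedFacts_of_pt_of_thm120` — the same as an implication over
  all pairs: «every pair of the door's cells with a Kriz–Li Heegner datum satisfies the leaf's body».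

READING (for the planner). The K1 door closes the leaf from {PrintedFacts, PT, r2, r3}
(`additiveX3RankOneLower_of_printedFacts_of_pt_of_branchIMCs`); on the sub-locus of pairs admitting a Kriz–Li
datum, r2 and r3 are replaced by ONE PUBLISHED THEOREM. What separates this from a class-wide statement is
exactly the EXISTENCE of such a datum per pair: hypotheses (1)–(3) are conditions on `(E, p)` ((1) automatic at
`p ≥ 5` on X3; at `p = 3` it fails on every isogeny class with a rational `3`-torsion member), and (4) asks for
a Heegner field `K` of the door with `B_{1,ψ₀⁻¹ε_K}·B_{1,ψ₀ω⁻¹} ≢ 0 (mod p)` AND `L(E^{d_K},1) ≠ 0` — a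
Davenport–Heilbronn / Goldfeld-type input (Kriz–Li §9–§10 at `p = 3`), not in the tree. Census of the locus
on the door's 7 101 pairs: kit job of this seat (evidence on item 19176).

References: [KrizLi2019] Thm. 1.20 (pp. 7–8) = Thm. 7.1 (pp. 42–43); [JetchevSkinnerWan2017] §7.4.1
(arXiv:1512.06894 p. 30); [GrossZagier1986] I.(6.3); [Kolyvagin1990] Thm. A; [MilneADT2006] I 4.10.
-/

noncomputable section

open scoped Classical

open Field NumberField IsDedekindDomain WeierstrassCurve
open Literature.NumberTheory.EllipticCurves Literature.NumberTheory.EllipticCurves.GreenbergSelmer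
open Literature.NumberTheory.GaloisRepresentations
open Literature.NumberTheory.GaloisCohomology
open Literature.NumberTheory.EllipticCurves.ModularForms
  Literature.NumberTheory.EllipticCurves.Rank1Residual
  Literature.NumberTheory.EllipticCurves.Rank1Residual.Typed
  Summit.BirchSwinnertonDyer.Rank1Residual
  Summit.BirchSwinnertonDyer.Rank1Residual.X11b
  Summit.BirchSwinnertonDyer.Rank1Residual.X11b.AcSelmer
  Summit.BirchSwinnertonDyer.BirchSwinnertonDyer.Theorems.SchneiderFree
  Summit.BirchSwinnertonDyer.BirchSwinnertonDyer.Theorems.SchneiderFreeControlAtoms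

set_option linter.dupNamespace false
set_option autoImplicit false

namespace Summit.BirchSwinnertonDyer.BirchSwinnertonDyer.Theorems.SchneiderFreeAdditiveX3

open Summit.BirchSwinnertonDyer.BirchSwinnertonDyer.Theses.SchneiderFreeAdditiveX3

/-- **The leaf's body at a pair of the door carrying a Kriz–Li Heegner datum — from `PrintedFacts`,
Poitou–Tate duality and Kriz–Li 2019 Thm. 1.20, NO branch main conjecture.** For a globally minimal `W/ℚ`
with `r_an = 1`, an odd prime `p` with `ClassX3 W p` and `E^{(p*)}` semistable at `p`, and a Heegner datum
of the door `(N = N_W, K, Dt, H, ι, P)` (`K` imaginary quadratic with odd `d_K`, `p ∤ #𝓞_K^×`, the Heegner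
hypothesis for `N`, `L(E^{d_K}, 1) ≠ 0`, `ι(P)` the Heegner point, `P` of infinite order) at which Kriz–Li's
hypotheses hold (a primitive `ψ` of conductor `f` and the Teichmüller `ω` with `E[p]^{ss} ≅ 𝔽_p(ψ) ⊕ 𝔽_p(ψ⁻¹ω)`
in trace form; (1) `ψ(p) ≠ 1 ≠ (ψ⁻¹ω)(p)`; (2) no split multiplicative prime; (3) the additive-prime
condition; the Kronecker character `ε_K` and (4) `B_{1,ψ₀⁻¹ε_K}·B_{1,ψ₀ω⁻¹} ≢ 0 (mod p)`):
`MissingLowerBoundAt W p` — the lower half of BSD_p, i.e. the body of the rung leaf `AdditiveX3RankOneLower`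
at `(W, p)`. Proof = the route's `closes` at this datum with STEP L supplied frame-wise by the Kriz–Li socket
(`additiveIMCLowerBDPOnTreeLeAt_of_thm120`) and the control inequality / CTL₀ by Poitou–Tate + Kolyvagin.
CONDITIONAL on the three named-fact hypotheses; closes nothing by name.
[cite: KrizLi2019, Thm. 1.20 (pp. 7–8)] [cite: JetchevSkinnerWan2017, §7.4.1 (arXiv:1512.06894 p. 30)]
[cite: GrossZagier1986, Thm. I.(6.3)] -/
theorem missingLowerBoundAt_of_printedFacts_of_pt_of_krizLiDatum (hF : PrintedFacts)
    (hPT : ∀ (K : Type) [Field K] [NumberField K], poitouTate_selmerStructure_duality K)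
    (hKL : KrizLi2019.thm120_padicLogHeegner_unit_of_bernoulli)
    (W : WeierstrassCurve ℚ) [W.IsElliptic] [W.IsGloballyMinimal] (p : ℕ) [Fact p.Prime]
    (hr : W.analyticRank = 1) (hp2 : p ≠ 2) (hX : ClassX3 W p) (hS : Additive.SubSemistableTwist W p)
    -- a Heegner datum of the door at `(W, p)`
    (N : ℕ) [NeZero N] (K : Type) [Field K] [NumberField K]
    (Dt : ModularParametrizationData W N) (H : HeegnerDatum N (NumberField.discr K)) (ι : K →+* ℂ)
    (P : (W.baseChange K).toAffine.Point)
    (hN : W.conductorNorm ℤ = N) (hK : IsImaginaryQuadratic K) (hodd : Odd (NumberField.discr K))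
    (hunit : ¬ p ∣ Units.torsionOrder K) (hHe : SatisfiesHeegnerHypothesis N K)
    (hLt : (W.quadraticTwist (NumberField.discr K : ℚ)).entireLFunction 1 ≠ 0)
    (hP : WeierstrassCurve.Affine.Point.map ι.toRatAlgHom P = heegnerPointComplex Dt H)
    (hnt : ¬ IsOfFinAddOrder P)
    -- Kriz–Li's binders at `(W, p)`
    (f : ℕ) [NeZero f] (ψ : DirichletCharacter ℚ_[p] f) (ω : DirichletCharacter ℚ_[p] p)
    (hψ : ψ.IsPrimitive) (hω : KrizLi2019.IsTeichmullerCharacter ω)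
    (hss : ∀ ℓ : ℕ, ℓ.Prime → ¬ (ℓ ∣ p * W.conductorNorm ℤ) →
      ‖((W.LFunction ℓ : ℤ) : ℚ_[p]) -
          (ψ (ℓ : ZMod f) + ψ⁻¹ (ℓ : ZMod f) * ω (ℓ : ZMod p))‖ < 1)
    (h1 : ψ (p : ZMod f) ≠ 1) (h1' : KrizLi2019.primVal (KrizLi2019.invMulOmega ψ ω) p ≠ 1)
    (h2 : ∀ ℓ : ℕ, (hℓ : ℓ.Prime) →
      ¬ (haveI := Fact.mk hℓ; W.HasSplitMultiplicativeReductionAtPrime ℓ))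
    (h3 : ∀ ℓ : ℕ, (hℓ : ℓ.Prime) → ℓ ≠ p →
      (haveI := Fact.mk hℓ;
        ¬ W.HasGoodReductionAtPrime ℓ ∧ ¬ W.HasMultiplicativeReductionAtPrime ℓ) →
      ψ (ℓ : ZMod f) ≠ 1 ∧ KrizLi2019.primVal (KrizLi2019.invMulOmega ψ ω) ℓ ≠ 1)
    -- Kriz–Li's binders at `K`
    (εK : DirichletCharacter ℚ_[p] (NumberField.discr K).natAbs)
    (hεK : KrizLi2019.IsKroneckerCharacterOf K εK)
    (h4 : ¬ (‖KrizLi2019.bernoulliOnePrim (KrizLi2019.bernoulliCharOne ψ εK) *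
        KrizLi2019.bernoulliOnePrim (KrizLi2019.bernoulliCharTwo ψ εK ω)‖ ≤ (p : ℝ)⁻¹)) :
    MissingLowerBoundAt W p := by
  obtain ⟨hGZ, hKo, hGZK, hmod, hmodD, hCas, hGZ73, -, -, -, hDel, hW16, hWu⟩ := hF
  have hJ : JointLowerManin := schneiderFreeAdditiveX3_jointLowerManin_proof
  have hU : PartnerUpperRankZero := schneiderFreeAdditiveX3_partnerUpperRankZero_proof
  -- the pair lies on the N10 locus
  have hloc : Additive.N10.Locus W p :=
    (Additive.N10.locus_iff_cells W p).mpr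
      ((Additive.N10.cellM_or_cellGordTwo_of_classX3_of_subSemistableTwist W p hp2 hX hS).elim Or.inl
        (fun h ↦ Or.inr (Or.inl h)))
  -- `Ш(E/K)` is finite (Kolyvagin, `P` non-torsion)
  have hfin : (W.baseChange K).ShaFinite := (hKo N W K hK hHe ⟨Dt, H, ι, hP⟩ hnt).2
  -- STEP L at THIS datum: the Kriz–Li socket at every frame + the control inequality at every frame
  have hidx : IndexLowerBoundLeAt W p K P (padicValNat p Dt.c.natAbs) := by
    refine indexLowerBoundLeAt_of_frames_of_shaFinite_le hloc hN hK hHe hfin ?_ ?_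
    · intro κ hκ γ _ 𝔭 h𝔭 he hf
      exact additiveIMCLowerBDPOnTreeLeAt_of_thm120 hKL W p N K Dt H ι P hloc hN hK hHe hP f ψ ω hψ hω hss
        h1 h1' h2 h3 εK hεK h4 κ γ 𝔭 h𝔭 he hf
        (exists_hasCharValuationAt_of_pt_of_kolyvagin hPT hKo W p hr hp2 hX hS N K Dt H ι P hr hloc hN hK
          hodd hunit hHe hLt hP hnt κ hκ γ 𝔭 h𝔭 he hf)
    · intro κ hκ γ _ 𝔭 h𝔭 he hf
      exact additiveControlLeOnTreeAt_of_pt_of_kolyvagin hPT hKo W p hr hp2 hX hS N K Dt H ι P hr hloc hN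
        hK hodd hunit hHe hLt hP hnt κ hκ γ 𝔭 h𝔭 he hf
  -- a globally minimal model of the twist `E^{d_K}`, of analytic rank zero, on the same cells
  subst hN
  have hD0 : (NumberField.discr K : ℚ) ≠ 0 := by exact_mod_cast NumberField.discr_ne_zero K
  haveI hEt : (W.quadraticTwist (NumberField.discr K : ℚ)).IsElliptic :=
    W.isElliptic_quadraticTwist hD0
  obtain ⟨Cd, hCd⟩ := hasGlobalMinimalModel_rat_holds (W.quadraticTwist (NumberField.discr K : ℚ))
  set Wd : WeierstrassCurve ℚ := Cd • W.quadraticTwist (NumberField.discr K : ℚ) with hWd_def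
  haveI : Wd.IsGloballyMinimal := hCd
  have hWd : Cd • W.quadraticTwist (NumberField.discr K : ℚ) = Wd := rfl
  have hrt : (W.quadraticTwist (NumberField.discr K : ℚ)).analyticRank = 0 :=
    ((W.quadraticTwist _).analyticRank_eq_zero_iff_holds (hmod _)).2 hLt
  have hrd : Wd.analyticRank = 0 := by rw [← hWd, analyticRank_smul, hrt]
  have hXd : ClassX3 Wd p := SchneiderFree.classX3_twist_of_heegner p W K hK hHe hX Cd hWd
  have hSd : Additive.SubSemistableTwist Wd p :=
    SchneiderFree.subSemistableTwist_twist_of_heegner p W hp2 K hK hodd hHe hX.2 Cd hWd hS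
  -- Gross–Zagier bookkeeping (item `JointLowerManin`) and the partner's upper half (item `PartnerUpperRankZero`)
  have hJ' : JointLowerBoundAt W Wd p :=
    hJ hGZ hKo hGZK hmod hmodD hCas hGZ73 W p (W.conductorNorm ℤ) K Dt H ι P Wd hr rfl hK hodd hunit hHe
      hLt hP hnt ⟨Cd, hWd⟩ hrd hp2 hidx
  exact missingLowerBoundAt_of_joint_of_upper hJ' (hU hDel hGZK hmod hmodD hW16 hWu Wd p hrd hp2 hXd hSd)

/-- **The rung leaf ON THE KRIZ–LI LOCUS OF THE DOOR, class level.** From `PrintedFacts`, Poitou–Tate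
duality and Kriz–Li 2019 Thm. 1.20: EVERY pair `(W, p)` of the door's cells (`r_an = 1`, `p ≠ 2`, `ClassX3`,
semistable twist) that admits a Heegner datum of the door with Kriz–Li's hypotheses (1)–(4) satisfies the
leaf's body `MissingLowerBoundAt W p` — the branch cruxes r2 `PotMultBranchIMC` / r3 `GordTwoBranchIMC` are
NOT used. Compare `additiveX3RankOneLower_of_printedFacts_of_pt_of_branchIMCs` (all pairs, from r2 ∧ r3).
The gap to the leaf itself is the EXISTENCE of such a datum at every pair — false at `p = 3` on the classes
with a rational `3`-torsion member (hypothesis (1)), open in general (a Goldfeld-type input). CONDITIONAL;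
closes nothing by name. [cite: KrizLi2019, Thm. 1.20 (pp. 7–8)]
[cite: JetchevSkinnerWan2017, §7.4.1 (arXiv:1512.06894 p. 30)] -/
theorem additiveX3RankOneLower_onKrizLiLocus_of_printedFacts_of_pt_of_thm120 (hF : PrintedFacts)
    (hPT : ∀ (K : Type) [Field K] [NumberField K], poitouTate_selmerStructure_duality K)
    (hKL : KrizLi2019.thm120_padicLogHeegner_unit_of_bernoulli) :
    ∀ (W : WeierstrassCurve ℚ) [W.IsElliptic] [W.IsGloballyMinimal] (p : ℕ) [Fact p.Prime],
      W.analyticRank = 1 → p ≠ 2 → ClassX3 W p → Additive.SubSemistableTwist W p →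
      -- «`(W, p)` admits a Kriz–Li Heegner datum of the door»
      (∃ (N : ℕ) (_ : NeZero N) (K : Type) (_ : Field K) (_ : NumberField K)
          (Dt : ModularParametrizationData W N) (H : HeegnerDatum N (NumberField.discr K)) (ι : K →+* ℂ)
          (P : (W.baseChange K).toAffine.Point)
          (f : ℕ) (_ : NeZero f) (ψ : DirichletCharacter ℚ_[p] f) (ω : DirichletCharacter ℚ_[p] p)
          (εK : DirichletCharacter ℚ_[p] (NumberField.discr K).natAbs),
        W.conductorNorm ℤ = N ∧ IsImaginaryQuadratic K ∧ Odd (NumberField.discr K) ∧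
        ¬ p ∣ Units.torsionOrder K ∧ SatisfiesHeegnerHypothesis N K ∧
        (W.quadraticTwist (NumberField.discr K : ℚ)).entireLFunction 1 ≠ 0 ∧
        WeierstrassCurve.Affine.Point.map ι.toRatAlgHom P = heegnerPointComplex Dt H ∧
        ¬ IsOfFinAddOrder P ∧
        ψ.IsPrimitive ∧ KrizLi2019.IsTeichmullerCharacter ω ∧
        (∀ ℓ : ℕ, ℓ.Prime → ¬ (ℓ ∣ p * W.conductorNorm ℤ) →
          ‖((W.LFunction ℓ : ℤ) : ℚ_[p]) -
              (ψ (ℓ : ZMod f) + ψ⁻¹ (ℓ : ZMod f) * ω (ℓ : ZMod p))‖ < 1) ∧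
        ψ (p : ZMod f) ≠ 1 ∧ KrizLi2019.primVal (KrizLi2019.invMulOmega ψ ω) p ≠ 1 ∧
        (∀ ℓ : ℕ, (hℓ : ℓ.Prime) →
          ¬ (haveI := Fact.mk hℓ; W.HasSplitMultiplicativeReductionAtPrime ℓ)) ∧
        (∀ ℓ : ℕ, (hℓ : ℓ.Prime) → ℓ ≠ p →
          (haveI := Fact.mk hℓ;
            ¬ W.HasGoodReductionAtPrime ℓ ∧ ¬ W.HasMultiplicativeReductionAtPrime ℓ) →
          ψ (ℓ : ZMod f) ≠ 1 ∧ KrizLi2019.primVal (KrizLi2019.invMulOmega ψ ω) ℓ ≠ 1) ∧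
        KrizLi2019.IsKroneckerCharacterOf K εK ∧
        ¬ (‖KrizLi2019.bernoulliOnePrim (KrizLi2019.bernoulliCharOne ψ εK) *
            KrizLi2019.bernoulliOnePrim (KrizLi2019.bernoulliCharTwo ψ εK ω)‖ ≤ (p : ℝ)⁻¹)) →
      MissingLowerBoundAt W p := by
  intro W _ _ p _ hr hp2 hX hS hdat
  obtain ⟨N, _, K, _, _, Dt, H, ι, P, f, _, ψ, ω, εK, hN, hK, hodd, hunit, hHe, hLt, hP, hnt, hψ, hω, hss,
    h1, h1', h2, h3, hεK, h4⟩ := hdat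
  exact missingLowerBoundAt_of_printedFacts_of_pt_of_krizLiDatum hF hPT hKL W p hr hp2 hX hS N K Dt H ι P hN
    hK hodd hunit hHe hLt hP hnt f ψ ω hψ hω hss h1 h1' h2 h3 εK hεK h4

end Summit.BirchSwinnertonDyer.BirchSwinnertonDyer.Theorems.SchneiderFreeAdditiveX3

end
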